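import Mathlib.Algebra.Module.Submodule.Pointwise
import Mathlib.GroupTheory.Index
import Mathlib.GroupTheory.Coset.Card
import Mathlib.Data.Finite.Perm
import Mathlib.LinearAlgebra.FiniteDimensional.Basic
import Literature.InformationTheory.QuantumCodes.AdditiveCodeShortening
import Literature.InformationTheory.QuantumCodes.DistanceTwoOddLength
import Literature.InformationTheory.QuantumCodes.AdditiveCodeMassFormula
import HarnessLib

/-!
# The equivalence group `𝒢ₙ = S₃ ≀ Sₙ` of additive codes, its order `6ⁿ·n!`, and CRSS eq. (6)

Topic `Literature/InformationTheory/QuantumCodes` (LADDER-QEC, LIT-1 custody: code families and published code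
tables — here the EQUIVALENCE of additive / stabilizer codes under which every classification table counts classes,
and the orbit–stabilizer identity behind the mass formula). Everything is PROVED (no named facts, no instances).

**Source (read on the page).** Calderbank–Rains–Shor–Sloane, *Quantum error correction via codes over GF(4)*,
IEEE Trans. Inform. Theory 44 (1998) 1369–1387 = arXiv:quant-ph/9608006v5 [CalderbankEtAl1998], §3 (PDF p. 12 =
printed p. 11):

> Let `𝒢ₙ` denote the group of order `6ⁿ n!` generated by permutations of the `n` coordinates, multiplication of
> any coordinates by `ω`, and conjugation of any coordinates. Equivalently, `𝒢ₙ` is the wreath product of `S₃` by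
> `Sₙ` generated by permutations of the coordinates and arbitrary permutations of the nonzero elements of `GF(4)`
> in each coordinate. `𝒢ₙ` preserves weights and trace inner products. Two additive codes over `GF(4)` of length
> `n` are said to be equivalent if one can be obtained from the other by applying an element of `𝒢ₙ`. The subgroup
> of `𝒢ₙ` fixing a code `C` is its automorphism group `Aut(C)`. The number of codes equivalent to `C` is then
> equal to `6ⁿ n! / |Aut(C)|`.  (6)

**The tree's rendering.** In the binary language of `SymplecticCodes.lean` (`Ē = SympVec n = 𝔽₂ⁿ × 𝔽₂ⁿ`, letters
`letterAt v q = (v.1 q, v.2 q) ∈ 𝔽₂²` with `X = (1,0)`, `Z = (0,1)`, `Y = (1,1)`), a coordinate permutation together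
with a permutation of the three nonzero letters in each coordinate is an `𝔽₂`-LINEAR automorphism of `Ē` (every
permutation of `{X, Y, Z}` is additive on `𝔽₂²`, as `X + Y + Z = 0`), and these are exactly the linear automorphisms
preserving the symplectic weight and the symplectic inner product — the predicate `IsSympIsometry` of
`AdditiveCodeShortening.lean`. We therefore DEFINE `codeEquivGroup n` ("`𝒢ₙ`") as the subgroup
`{g : Ē ≃ₗ Ē | IsSympIsometry g}` and PROVE the printed description:

* `codeEquivGroupEquiv : 𝒢ₙ ≃ Equiv.Perm (Fin n) × (Fin n → LocalDatum)` where a `LocalDatum` is the pair of images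
  `(π X, π Z)` of a permutation `π` of the nonzero letters (`letterForm (π X) (π Z) = 1`; `card_localDatum : 6` of them,
  `= |S₃|`) — i.e. `𝒢ₙ` IS the wreath product `S₃ ≀ Sₙ` as a set of maps (`monomial σ L`: move qubit `q` to `σ q` and
  apply the letter permutation `L q`); the substantive step is `exists_monomial_eq`: a weight- and form-preserving
  linear automorphism is monomial (weight-one vectors go to weight-one vectors; `g X_q`, `g Z_q` sit on one common
  qubit because `((g X_q, g Z_q)) = ((X_q, Z_q)) = 1`; distinct qubits go to distinct qubits by nondegeneracy of the
  letter form).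
* **`card_codeEquivGroup : Nat.card 𝒢ₙ = 6 ^ n * n !`** ("the group of order `6ⁿ n!`").
* The action on codes `S̄ ≤ Ē` is `g • S̄ = g(S̄)` (Mathlib's pointwise action of `Ē ≃ₗ Ē` on submodules, restricted to
  the subgroup); `Aut(S̄)` is `MulAction.stabilizer 𝒢ₙ S̄`, the equivalence class of `S̄` is `MulAction.orbit 𝒢ₙ S̄`;
  equivalent codes have the same parameters (`isAdditiveCode_smul_iff`, from the tree's `IsAdditiveCode.map_isometry`).
* **`CRSS1998_eq6`**: `|orbit(S̄)| · |Aut(S̄)| = 6ⁿ · n!` (printed eq. (6), orbit–stabilizer).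

* §8 **the printed generators**: `closure_printedGenerators` — the subgroup generated by the coordinate permutations
  `permQubits σ`, the single-coordinate `ω`-multiplications `omegaAt q` and the single-coordinate conjugations
  `conjAt q` IS `codeEquivGroup n` (so the tree's definition and the printed definition of `𝒢ₙ` agree); with
  `LocalDatum.eq_words` (`S₃ = {id, ω, ω², c, cω, cω²}`).
* §6–§7 **the mass formula over classes** `sum_card_div_card_stabilizer_eq_card` (any `𝒢ₙ`-invariant finite set of
  codes `X` and transversal `R` of its classes: `Σ_{C ∈ R} 6ⁿ n!/|Aut(C)| = |X|`), its instance `massFormula_classes`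
  for the `[[n, n−m]]` codes (`X = isoSubspaces n m` of `AdditiveCodeMassFormula.lean`, so
  `Σ_classes 6ⁿ n!/|Aut| = ∏_{i<m}(2^{2n−i} − 2^i)/∏_{i<m}(2^m − 2^i)` — the exhaustiveness check of a classification
  of `[[n,k]]` stabilizer codes up to equivalence), and **`CRSS1998_theorem19b`**: for a complete set `R` of
  representatives of the inequivalent self-dual codes of length `n`, `Σ_{C ∈ R} 1/|Aut(C)| = ∏_{j=1}^{n}(2^j+1)/(6ⁿ n!)`
  (§6 Thm. 19 (b), printed p. 23, "From (a) and (6)" — here from `CRSS1998_theorem19a` and `CRSS1998_eq6`).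

## Tree / Mathlib search (2026-08-27)
Tree: `IsSympIsometry`, `IsSympIsometry.trans`, `permQubits`, `isSympIsometry_permQubits`, `IsAdditiveCode.map_isometry`
(`AdditiveCodeShortening.lean`, which says "Deliberately NOT here: the general equivalence group (all `S_3` letter
permutations per qubit), automorphism groups" — supplied here); `letterAt` (`DistanceTwoOddLength.lean`); `singleErr`,
`exists_singleErr_of_sympWeight_eq_one` (`QuantumHammingBoundDistanceThree.lean` / `DistanceThreeCodes8m.lean`).
Mathlib: `LinearEquiv.automorphismGroup`, `Submodule.pointwiseDistribMulAction` (scoped `Pointwise`),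
`MulAction.index_stabilizer`, `Subgroup.index_mul_card`, `Nat.card_perm`, `Nat.card_fun`, `LinearEquiv.ofInjectiveEndo`,
`LinearMap.prod_ext` / `LinearMap.pi_ext`. No wreath product `S₃ ≀ Sₙ` with its permutation action is in Mathlib
(`RegularWreathProduct` is the regular one), hence the concrete description by monomial data.
-/

namespace Literature.InformationTheory.QuantumCodes

open Finset Module

open scoped Classical Pointwise

variable {n : ℕ}

/-! ### §1. Letters: the one-qubit symplectic form -/

/-- The symplectic form on one letter `𝔽₂²`: `((p, r)) = p₁ r₂ + r₁ p₂` (`= 1` iff the two one-qubit Paulis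
anticommute). [cite: CalderbankEtAl1998, §2 eq. (1) (printed p. 4), case n = 1] -/
def letterForm (p r : ZMod 2 × ZMod 2) : ZMod 2 := p.1 * r.2 + r.1 * p.2

/-- `((p, p)) = 0`. [cite: CalderbankEtAl1998, §2 eq. (2) (printed p. 4)] -/
theorem letterForm_self (p : ZMod 2 × ZMod 2) : letterForm p p = 0 := by
  unfold letterForm
  have : ∀ a b : ZMod 2, a * b + a * b = 0 := by decide
  rw [mul_comm p.1 p.2]
  exact this _ _

/-- `((p, r)) = ((r, p))`. [cite: CalderbankEtAl1998, §2 eq. (3) (printed p. 4)] -/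
theorem letterForm_comm (p r : ZMod 2 × ZMod 2) : letterForm p r = letterForm r p := by
  unfold letterForm; ring

/-- `((p, r)) = 1` iff `p, r` are two DISTINCT NONZERO letters (two different non-identity Paulis anticommute).
[cite: CalderbankEtAl1998, §2 (printed p. 4: the images of (1) in Ē … commute/anticommute)] -/
theorem letterForm_eq_one_iff (p r : ZMod 2 × ZMod 2) : letterForm p r = 1 ↔ p ≠ 0 ∧ r ≠ 0 ∧ p ≠ r := by
  revert p r; unfold letterForm; decide

/-- Nondegeneracy of the letter form: a letter orthogonal to an anticommuting pair is `0`.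
[cite: CalderbankEtAl1998, §2 (printed p. 4), case n = 1] -/
theorem eq_zero_of_letterForm_pair {p r c : ZMod 2 × ZMod 2} (hpr : letterForm p r = 1)
    (hp : letterForm p c = 0) (hr : letterForm r c = 0) : c = 0 := by
  revert p r c; unfold letterForm; decide

/-- Expansion in an anticommuting pair: if `((a, b)) = 1` then every letter `w` equals `((w,b))·a + ((w,a))·b`.
[cite: CalderbankEtAl1998, §2 (printed p. 4), case n = 1] -/
theorem letter_expand {a b : ZMod 2 × ZMod 2} (hab : letterForm a b = 1) (w : ZMod 2 × ZMod 2) :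
    w = letterForm w b • a + letterForm w a • b := by
  revert a b w; unfold letterForm; decide

/-- The symplectic inner product is the sum of the letter forms over the qubits.
[cite: CalderbankEtAl1998, §2 eq. (1) (printed p. 4)] -/
theorem sympInner_eq_sum_letterForm (v w : SympVec n) :
    sympInner v w = ∑ q, letterForm (letterAt v q) (letterAt w q) := by
  simp only [sympInner, dotProduct, letterForm, letterAt, ← Finset.sum_add_distrib]

/-- The symplectic weight is the number of qubits carrying a nonzero letter.
[cite: CalderbankEtAl1998, §2 (printed p. 4: "The weight of (a|b) is the number of coordinates i such that a_i ≠ 0 or b_i ≠ 0")] -/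
theorem sympWeight_eq_card_letterAt_ne_zero (v : SympVec n) : sympWeight v = #{q | letterAt v q ≠ 0} := by
  unfold sympWeight
  congr 1; ext q
  simp only [Finset.mem_filter, Finset.mem_univ, true_and, letterAt, ne_eq, Prod.mk_eq_zero, not_and_or]

/-- Two vectors with the same letters are equal. [cite: CalderbankEtAl1998, §2 (printed p. 3: the vectors (a|b) ∈ Ē)] -/
theorem ext_letterAt {v w : SympVec n} (h : ∀ q, letterAt v q = letterAt w q) : v = w := by
  refine Prod.ext (funext fun q => ?_) (funext fun q => ?_)
  · exact congrArg Prod.fst (h q)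
  · exact congrArg Prod.snd (h q)

/-- `letterAt` is additive. [cite: CalderbankEtAl1998, §2 (printed p. 3)] -/
theorem letterAt_add' (v w : SympVec n) (q : Fin n) : letterAt (v + w) q = letterAt v q + letterAt w q := rfl

/-- `letterAt` commutes with scalars. [cite: CalderbankEtAl1998, §2 (printed p. 3)] -/
theorem letterAt_smul' (c : ZMod 2) (v : SympVec n) (q : Fin n) : letterAt (c • v) q = c • letterAt v q := rfl

/-- The letters of a single-qubit error. [cite: Gottesman1997, Ch. 7 §7.3 (single-qubit errors X_j, Y_j, Z_j)] -/
theorem letterAt_singleErr' (i j : Fin n) (p : ZMod 2 × ZMod 2) :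
    letterAt (singleErr i p) j = if j = i then p else 0 := by
  unfold letterAt singleErr
  by_cases h : j = i
  · subst h; simp
  · simp [h]

/-- A vector is the sum of its letters placed as single-qubit errors: `v = Σ_q (letter_q v)_q`.
[cite: CalderbankEtAl1998, §2 (printed p. 4: X ↔ (1|0), Z ↔ (0|1))] -/
theorem sum_singleErr_letterAt (v : SympVec n) : ∑ q, singleErr q (letterAt v q) = v := by
  refine ext_letterAt fun p => ?_
  have hsum : ∀ s : Finset (Fin n), letterAt (∑ q ∈ s, singleErr q (letterAt v q)) p =
      ∑ q ∈ s, letterAt (singleErr q (letterAt v q)) p := by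
    intro s
    induction s using Finset.induction_on with
    | empty => rfl
    | insert a s ha ih => rw [Finset.sum_insert ha, Finset.sum_insert ha, letterAt_add', ih]
  rw [hsum]
  simp only [letterAt_singleErr']
  rw [Finset.sum_ite_eq]
  simp

/-- `((p, 0)) = 0`. [cite: CalderbankEtAl1998, §2 eq. (1) (printed p. 4)] -/
@[simp] theorem letterForm_zero_right (p : ZMod 2 × ZMod 2) : letterForm p 0 = 0 := by simp [letterForm]

/-- `((0, p)) = 0`. [cite: CalderbankEtAl1998, §2 eq. (1) (printed p. 4)] -/
@[simp] theorem letterForm_zero_left (p : ZMod 2 × ZMod 2) : letterForm 0 p = 0 := by simp [letterForm]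

/-- The symplectic inner product of two single-qubit words: the letter form if they sit on the same qubit, else `0`.
[cite: CalderbankEtAl1998, §2 eq. (1) (printed p. 4)] -/
theorem sympInner_singleErr_singleErr (i j : Fin n) (a b : ZMod 2 × ZMod 2) :
    sympInner (singleErr i a) (singleErr j b) = if j = i then letterForm a b else 0 := by
  rw [sympInner_eq_sum_letterForm]
  simp only [letterAt_singleErr']
  rw [Finset.sum_eq_single i (fun x _ hx => by rw [if_neg hx, letterForm_zero_left]) (by simp)]
  rw [if_pos rfl]
  by_cases h : j = i
  · subst h; rw [if_pos rfl, if_pos rfl]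
  · rw [if_neg (Ne.symm h), if_neg h, letterForm_zero_right]

/-- The letter `X = (1,0)` resp. `Z = (0,1)` on qubit `q`. [cite: CalderbankEtAl1998, §2 (printed p. 4)] -/
theorem singleErr_X_eq (q : Fin n) : singleErr q ((1, 0) : ZMod 2 × ZMod 2) = ((Pi.single q 1, 0) : SympVec n) := by
  unfold singleErr; ext i <;> simp [Pi.single_apply]

/-- [cite: CalderbankEtAl1998, §2 (printed p. 4)] -/
theorem singleErr_Z_eq (q : Fin n) : singleErr q ((0, 1) : ZMod 2 × ZMod 2) = ((0, Pi.single q 1) : SympVec n) := by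
  unfold singleErr; ext i <;> simp [Pi.single_apply]

/-- Two linear maps out of `Ē` that agree on all `X_q` and `Z_q` are equal.
[cite: CalderbankEtAl1998, §2 (printed p. 4: Ē is spanned by the images of X_i, Z_i)] -/
theorem linearMap_ext_XZ {N : Type*} [AddCommMonoid N] [Module (ZMod 2) N] {f g : SympVec n →ₗ[ZMod 2] N}
    (hX : ∀ q, f (singleErr q (1, 0)) = g (singleErr q (1, 0)))
    (hZ : ∀ q, f (singleErr q (0, 1)) = g (singleErr q (0, 1))) : f = g := by
  refine LinearMap.prod_ext (LinearMap.pi_ext fun q x => ?_) (LinearMap.pi_ext fun q x => ?_)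
  · have hx : (Pi.single q x : Fin n → ZMod 2) = x • Pi.single q 1 := by
      rw [← Pi.single_smul', smul_eq_mul, mul_one]
    simp only [LinearMap.coe_comp, Function.comp_apply, LinearMap.inl_apply, hx]
    have := hX q
    rw [singleErr_X_eq] at this
    rw [show ((x • Pi.single q (1 : ZMod 2), (0 : Fin n → ZMod 2)) : SympVec n) =
      x • ((Pi.single q 1, 0) : SympVec n) by simp, map_smul, map_smul, this]
  · have hx : (Pi.single q x : Fin n → ZMod 2) = x • Pi.single q 1 := by
      rw [← Pi.single_smul', smul_eq_mul, mul_one]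
    simp only [LinearMap.coe_comp, Function.comp_apply, LinearMap.inr_apply, hx]
    have := hZ q
    rw [singleErr_Z_eq] at this
    rw [show (((0 : Fin n → ZMod 2), x • Pi.single q (1 : ZMod 2)) : SympVec n) =
      x • ((0, Pi.single q 1) : SympVec n) by simp, map_smul, map_smul, this]

/-! ### §2. The equivalence group `𝒢ₙ` -/

/-- **The equivalence group `𝒢ₙ` of additive codes of length `n`**: the `𝔽₂`-linear automorphisms of `Ē` preserving
the symplectic inner product and the weight (`IsSympIsometry`) — proved below (`codeEquivGroupEquiv`,
`card_codeEquivGroup`) to be exactly the wreath product `S₃ ≀ Sₙ` of coordinate permutations and independent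
permutations of the three nonzero letters in each coordinate, of order `6ⁿ n!`.
[cite: CalderbankEtAl1998, §3 (printed p. 11: "Let 𝒢ₙ denote the group of order 6ⁿn! … 𝒢ₙ preserves weights and trace inner products")] -/
def codeEquivGroup (n : ℕ) : Subgroup (SympVec n ≃ₗ[ZMod 2] SympVec n) where
  carrier := {g | IsSympIsometry g}
  mul_mem' {f g} hf hg := by
    rw [Set.mem_setOf_eq, LinearEquiv.mul_eq_trans]
    exact IsSympIsometry.trans hg hf
  one_mem' := ⟨fun _ _ => rfl, fun _ => rfl⟩
  inv_mem' {g} hg := by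
    refine ⟨fun v w => ?_, fun v => ?_⟩
    · conv_rhs => rw [← g.apply_symm_apply v, ← g.apply_symm_apply w]
      exact (hg.1 _ _).symm
    · conv_rhs => rw [← g.apply_symm_apply v]
      exact (hg.2 _).symm

/-- Membership in `𝒢ₙ`. [cite: CalderbankEtAl1998, §3 (printed p. 11)] -/
theorem mem_codeEquivGroup_iff {g : SympVec n ≃ₗ[ZMod 2] SympVec n} :
    g ∈ codeEquivGroup n ↔ IsSympIsometry g := Iff.rfl

/-- Coordinate permutations lie in `𝒢ₙ`. [cite: CalderbankEtAl1998, §3 (printed p. 11: "generated by permutations of the n coordinates …")] -/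
theorem permQubits_mem_codeEquivGroup (σ : Equiv.Perm (Fin n)) : permQubits σ ∈ codeEquivGroup n :=
  isSympIsometry_permQubits σ

/-- `𝒢ₙ` is finite (a set of maps of the finite set `Ē`). [cite: CalderbankEtAl1998, §3 (printed p. 11: "the group of order 6ⁿn!")] -/
theorem finite_codeEquivGroup (n : ℕ) : Finite (codeEquivGroup n) := by
  haveI : Finite (SympVec n ≃ₗ[ZMod 2] SympVec n) :=
    Finite.of_injective (fun g : SympVec n ≃ₗ[ZMod 2] SympVec n => (g : SympVec n → SympVec n))
      (fun g h hgh => LinearEquiv.ext fun v => congrFun hgh v)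
  infer_instance

/-! ### §3. Local data and monomial maps: `𝒢ₙ = S₃ ≀ Sₙ` -/

/-- A **local datum** at one coordinate: the images `(π X, π Z)` of `X = (1,0)` and `Z = (0,1)` under a permutation
`π` of the three nonzero letters — any anticommuting ordered pair (`π Y = π X + π Z` is then the third letter).
[cite: CalderbankEtAl1998, §3 (printed p. 11: "arbitrary permutations of the nonzero elements of GF(4) in each coordinate")] -/
def LocalDatum : Type := {pr : (ZMod 2 × ZMod 2) × (ZMod 2 × ZMod 2) // letterForm pr.1 pr.2 = 1}

/-- There are `6 = |S₃|` local data. [cite: CalderbankEtAl1998, §3 (printed p. 11: "the wreath product of S₃ by Sₙ")] -/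
theorem card_localDatum : Nat.card LocalDatum = 6 := by
  rw [LocalDatum, Nat.card_eq_fintype_card]
  rfl

/-- The letter map of a local datum: `(x, z) ↦ x·a + z·b` (the additive extension of `X ↦ a`, `Z ↦ b`, `Y ↦ a + b`).
[cite: CalderbankEtAl1998, §3 (printed p. 11)] -/
def LocalDatum.act (L : LocalDatum) (p : ZMod 2 × ZMod 2) : ZMod 2 × ZMod 2 := p.1 • L.1.1 + p.2 • L.1.2

/-- The letter map of a local datum preserves the letter form (`S₃ = Sp₂(𝔽₂)`).
[cite: CalderbankEtAl1998, §3 (printed p. 11: "𝒢ₙ preserves … trace inner products")] -/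
theorem LocalDatum.letterForm_act (L : LocalDatum) (p r : ZMod 2 × ZMod 2) :
    letterForm (L.act p) (L.act r) = letterForm p r := by
  obtain ⟨⟨a, b⟩, hab⟩ := L
  revert a b p r
  unfold letterForm LocalDatum.act
  decide

/-- The letter map of a local datum sends nonzero letters to nonzero letters (and `0` to `0`).
[cite: CalderbankEtAl1998, §3 (printed p. 11: "𝒢ₙ preserves weights")] -/
theorem LocalDatum.act_ne_zero_iff (L : LocalDatum) (p : ZMod 2 × ZMod 2) : L.act p ≠ 0 ↔ p ≠ 0 := by
  obtain ⟨⟨a, b⟩, hab⟩ := L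
  revert a b p
  unfold letterForm LocalDatum.act
  decide

/-- The **monomial map** of a coordinate permutation `σ` and local data `L`: qubit `q` is moved to `σ q` and its
letter is transformed by `L q` — as a linear endomorphism of `Ē`.
[cite: CalderbankEtAl1998, §3 (printed p. 11: permutations of the coordinates and arbitrary permutations of the nonzero elements in each coordinate)] -/
def monomialMap (σ : Equiv.Perm (Fin n)) (L : Fin n → LocalDatum) : SympVec n →ₗ[ZMod 2] SympVec n where
  toFun v := (fun p => ((L (σ.symm p)).act (letterAt v (σ.symm p))).1,
    fun p => ((L (σ.symm p)).act (letterAt v (σ.symm p))).2)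
  map_add' v w := by
    ext p <;> simp only [letterAt, LocalDatum.act, Prod.fst_add, Prod.snd_add, Pi.add_apply, Prod.smul_fst,
      Prod.smul_snd, smul_eq_mul] <;> ring
  map_smul' c v := by
    ext p <;> simp only [letterAt, LocalDatum.act, Prod.fst_add, Prod.snd_add, Prod.smul_fst, Prod.smul_snd,
      Pi.smul_apply, smul_eq_mul, RingHom.id_apply] <;> ring

/-- The letters of a monomial image: `letter_{σ q}(M v) = L_q (letter_q v)`.
[cite: CalderbankEtAl1998, §3 (printed p. 11)] -/
theorem letterAt_monomialMap (σ : Equiv.Perm (Fin n)) (L : Fin n → LocalDatum) (v : SympVec n) (p : Fin n) :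
    letterAt (monomialMap σ L v) p = (L (σ.symm p)).act (letterAt v (σ.symm p)) := rfl

/-- A monomial map is injective. [cite: CalderbankEtAl1998, §3 (printed p. 11)] -/
theorem monomialMap_injective (σ : Equiv.Perm (Fin n)) (L : Fin n → LocalDatum) :
    Function.Injective (monomialMap σ L) := by
  rw [← LinearMap.ker_eq_bot, LinearMap.ker_eq_bot']
  intro v hv
  refine ext_letterAt fun q => ?_
  have h := congrArg (fun w => letterAt w (σ q)) hv
  simp only [letterAt_monomialMap, Equiv.symm_apply_apply] at h
  have h0 : letterAt (0 : SympVec n) (σ q) = 0 := rfl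
  rw [h0] at h
  by_contra hne
  exact ((L q).act_ne_zero_iff _).2 hne h

/-- The **monomial automorphism** `monomial σ L ∈ Ē ≃ₗ Ē`. [cite: CalderbankEtAl1998, §3 (printed p. 11)] -/
noncomputable def monomial (σ : Equiv.Perm (Fin n)) (L : Fin n → LocalDatum) : SympVec n ≃ₗ[ZMod 2] SympVec n :=
  LinearEquiv.ofInjectiveEndo (monomialMap σ L) (monomialMap_injective σ L)

/-- [cite: CalderbankEtAl1998, §3 (printed p. 11)] -/
theorem monomial_apply (σ : Equiv.Perm (Fin n)) (L : Fin n → LocalDatum) (v : SympVec n) :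
    monomial σ L v = monomialMap σ L v := rfl

/-- **Monomial maps are in `𝒢ₙ`**: they preserve the symplectic inner product and the weight.
[cite: CalderbankEtAl1998, §3 (printed p. 11: "𝒢ₙ preserves weights and trace inner products")] -/
theorem monomial_mem_codeEquivGroup (σ : Equiv.Perm (Fin n)) (L : Fin n → LocalDatum) :
    monomial σ L ∈ codeEquivGroup n := by
  refine ⟨fun v w => ?_, fun v => ?_⟩
  · rw [monomial_apply, monomial_apply, sympInner_eq_sum_letterForm, sympInner_eq_sum_letterForm]
    simp only [letterAt_monomialMap, LocalDatum.letterForm_act]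
    exact Equiv.sum_comp σ.symm (fun q => letterForm (letterAt v q) (letterAt w q))
  · rw [monomial_apply, sympWeight_eq_card_letterAt_ne_zero, sympWeight_eq_card_letterAt_ne_zero]
    simp only [letterAt_monomialMap, ne_eq, LocalDatum.act_ne_zero_iff]
    refine Finset.card_bij' (fun p _ => σ.symm p) (fun q _ => σ q) (fun p hp => ?_) (fun q hq => ?_)
      (fun p _ => σ.apply_symm_apply p) (fun q _ => σ.symm_apply_apply q)
    · simpa using hp
    · simpa using hq

/-! ### §4. Every element of `𝒢ₙ` is monomial -/

section Structure

variable {g : SympVec n ≃ₗ[ZMod 2] SympVec n}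

/-- For `g ∈ 𝒢ₙ`, the image of a nonzero single-qubit word is a nonzero single-qubit word.
[cite: CalderbankEtAl1998, §3 (printed p. 11: 𝒢ₙ preserves weights)] -/
theorem exists_eq_singleErr_of_mem (hg : g ∈ codeEquivGroup n) (q : Fin n) {p : ZMod 2 × ZMod 2} (hp : p ≠ 0) :
    ∃ (i : Fin n) (r : ZMod 2 × ZMod 2), r ≠ 0 ∧ g (singleErr q p) = singleErr i r := by
  refine exists_singleErr_of_sympWeight_eq_one ?_
  rw [hg.2, sympWeight_eq_card_letterAt_ne_zero, Finset.card_eq_one]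
  refine ⟨q, ?_⟩
  ext j
  simp only [Finset.mem_filter, Finset.mem_univ, true_and, Finset.mem_singleton, letterAt_singleErr']
  by_cases h : j = q <;> simp [h, hp]

/-- The qubit to which `g ∈ 𝒢ₙ` sends qubit `q` (read off from the image of `X_q`).
[cite: CalderbankEtAl1998, §3 (printed p. 11: permutations of the n coordinates)] -/
noncomputable def qubitOf (hg : g ∈ codeEquivGroup n) (q : Fin n) : Fin n :=
  Classical.choose (exists_eq_singleErr_of_mem hg q (p := (1, 0)) (by decide))

/-- The letter to which `g ∈ 𝒢ₙ` sends `X_q` (at qubit `qubitOf g q`). [cite: CalderbankEtAl1998, §3 (printed p. 11)] -/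
noncomputable def letterX (hg : g ∈ codeEquivGroup n) (q : Fin n) : ZMod 2 × ZMod 2 :=
  Classical.choose (Classical.choose_spec (exists_eq_singleErr_of_mem hg q (p := (1, 0)) (by decide)))

/-- [cite: CalderbankEtAl1998, §3 (printed p. 11)] -/
theorem letterX_ne_zero (hg : g ∈ codeEquivGroup n) (q : Fin n) : letterX hg q ≠ 0 :=
  (Classical.choose_spec (Classical.choose_spec
    (exists_eq_singleErr_of_mem hg q (p := (1, 0)) (by decide)))).1

/-- `g X_q = (letterX)_{qubitOf q}`. [cite: CalderbankEtAl1998, §3 (printed p. 11)] -/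
theorem apply_X_eq (hg : g ∈ codeEquivGroup n) (q : Fin n) :
    g (singleErr q (1, 0)) = singleErr (qubitOf hg q) (letterX hg q) :=
  (Classical.choose_spec (Classical.choose_spec
    (exists_eq_singleErr_of_mem hg q (p := (1, 0)) (by decide)))).2

/-- `g Z_q` is a single-qubit word ON THE SAME QUBIT `qubitOf q` (because `((g X_q, g Z_q)) = ((X_q, Z_q)) = 1`), with a
letter `b` satisfying `((letterX, b)) = 1`. [cite: CalderbankEtAl1998, §3 (printed p. 11: 𝒢ₙ preserves trace inner products)] -/
theorem exists_apply_Z_eq (hg : g ∈ codeEquivGroup n) (q : Fin n) :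
    ∃ b : ZMod 2 × ZMod 2, letterForm (letterX hg q) b = 1 ∧ g (singleErr q (0, 1)) = singleErr (qubitOf hg q) b := by
  obtain ⟨i, b, -, hgi⟩ := exists_eq_singleErr_of_mem hg q (p := (0, 1)) (by decide)
  have hform : sympInner (g (singleErr q (1, 0))) (g (singleErr q (0, 1))) = 1 := by
    rw [hg.1, sympInner_singleErr_singleErr, if_pos rfl]; decide
  rw [apply_X_eq hg, hgi, sympInner_singleErr_singleErr] at hform
  by_cases hi : i = qubitOf hg q
  · rw [if_pos hi] at hform
    rw [hi] at hgi
    exact ⟨b, hform, hgi⟩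
  · rw [if_neg hi] at hform
    exact absurd hform zero_ne_one

/-- The letter to which `g ∈ 𝒢ₙ` sends `Z_q`. [cite: CalderbankEtAl1998, §3 (printed p. 11)] -/
noncomputable def letterZ (hg : g ∈ codeEquivGroup n) (q : Fin n) : ZMod 2 × ZMod 2 :=
  Classical.choose (exists_apply_Z_eq hg q)

/-- [cite: CalderbankEtAl1998, §3 (printed p. 11)] -/
theorem letterForm_letterX_letterZ (hg : g ∈ codeEquivGroup n) (q : Fin n) :
    letterForm (letterX hg q) (letterZ hg q) = 1 :=
  (Classical.choose_spec (exists_apply_Z_eq hg q)).1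

/-- `g Z_q = (letterZ)_{qubitOf q}`. [cite: CalderbankEtAl1998, §3 (printed p. 11)] -/
theorem apply_Z_eq (hg : g ∈ codeEquivGroup n) (q : Fin n) :
    g (singleErr q (0, 1)) = singleErr (qubitOf hg q) (letterZ hg q) :=
  (Classical.choose_spec (exists_apply_Z_eq hg q)).2

/-- The qubit map of `g ∈ 𝒢ₙ` is injective (distinct coordinates go to distinct coordinates: a third nonzero letter
on the qubit of `g X_q, g Z_q` orthogonal to both would contradict nondegeneracy of the letter form).
[cite: CalderbankEtAl1998, §3 (printed p. 11: permutations of the n coordinates)] -/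
theorem qubitOf_injective (hg : g ∈ codeEquivGroup n) : Function.Injective (qubitOf hg) := by
  intro q q' hqq
  by_contra hne
  -- the letters a = g X_q, b = g Z_q, c = g X_{q'} all sit on the qubit qubitOf q = qubitOf q'
  have hXX : sympInner (g (singleErr q (1, 0))) (g (singleErr q' (1, 0))) = 0 := by
    rw [hg.1, sympInner_singleErr_singleErr, if_neg (Ne.symm hne)]
  have hZX : sympInner (g (singleErr q (0, 1))) (g (singleErr q' (1, 0))) = 0 := by
    rw [hg.1, sympInner_singleErr_singleErr, if_neg (Ne.symm hne)]
  rw [apply_X_eq hg, apply_X_eq hg, ← hqq, sympInner_singleErr_singleErr, if_pos rfl] at hXX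
  rw [apply_Z_eq hg, apply_X_eq hg, ← hqq, sympInner_singleErr_singleErr, if_pos rfl] at hZX
  exact letterX_ne_zero hg q' (eq_zero_of_letterForm_pair (letterForm_letterX_letterZ hg q) hXX hZX)

/-- The **coordinate permutation** `σ_g ∈ Sₙ` of `g ∈ 𝒢ₙ`. [cite: CalderbankEtAl1998, §3 (printed p. 11)] -/
noncomputable def permOf (hg : g ∈ codeEquivGroup n) : Equiv.Perm (Fin n) :=
  Equiv.ofBijective (qubitOf hg) (Finite.injective_iff_bijective.1 (qubitOf_injective hg))

/-- [cite: CalderbankEtAl1998, §3 (printed p. 11)] -/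
theorem permOf_apply (hg : g ∈ codeEquivGroup n) (q : Fin n) : permOf hg q = qubitOf hg q := rfl

/-- The **local data** of `g ∈ 𝒢ₙ`: at coordinate `q`, the letter permutation `X ↦ letterX`, `Z ↦ letterZ`.
[cite: CalderbankEtAl1998, §3 (printed p. 11)] -/
noncomputable def localOf (hg : g ∈ codeEquivGroup n) (q : Fin n) : LocalDatum :=
  ⟨(letterX hg q, letterZ hg q), letterForm_letterX_letterZ hg q⟩

/-- **Structure theorem: every `g ∈ 𝒢ₙ` is the monomial map of its permutation and local data.**
[cite: CalderbankEtAl1998, §3 (printed p. 11: "Equivalently, 𝒢ₙ is the wreath product of S₃ by Sₙ generated by permutations of the coordinates and arbitrary permutations of the nonzero elements of GF(4) in each coordinate")] -/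
theorem monomial_permOf_localOf (hg : g ∈ codeEquivGroup n) : monomial (permOf hg) (localOf hg) = g := by
  refine LinearEquiv.toLinearMap_injective (linearMap_ext_XZ (fun q => ?_) (fun q => ?_))
  · rw [LinearEquiv.coe_coe, LinearEquiv.coe_coe, monomial_apply, apply_X_eq hg]
    refine ext_letterAt fun p => ?_
    rw [letterAt_monomialMap, letterAt_singleErr', letterAt_singleErr']
    by_cases hp : p = qubitOf hg q
    · subst hp
      have : (permOf hg).symm (qubitOf hg q) = q := by
        rw [← permOf_apply hg, Equiv.symm_apply_apply]
      rw [this, if_pos rfl, if_pos rfl]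
      simp [LocalDatum.act, localOf]
    · rw [if_neg hp, if_neg]
      · simp [LocalDatum.act]
      · intro h
        apply hp
        rw [← h, ← permOf_apply hg, Equiv.apply_symm_apply]
  · rw [LinearEquiv.coe_coe, LinearEquiv.coe_coe, monomial_apply, apply_Z_eq hg]
    refine ext_letterAt fun p => ?_
    rw [letterAt_monomialMap, letterAt_singleErr', letterAt_singleErr']
    by_cases hp : p = qubitOf hg q
    · subst hp
      have : (permOf hg).symm (qubitOf hg q) = q := by
        rw [← permOf_apply hg, Equiv.symm_apply_apply]
      rw [this, if_pos rfl, if_pos rfl]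
      simp [LocalDatum.act, localOf]
    · rw [if_neg hp, if_neg]
      · simp [LocalDatum.act]
      · intro h
        apply hp
        rw [← h, ← permOf_apply hg, Equiv.apply_symm_apply]

/-- Every element of `𝒢ₙ` is monomial. [cite: CalderbankEtAl1998, §3 (printed p. 11)] -/
theorem exists_monomial_eq (hg : g ∈ codeEquivGroup n) :
    ∃ (σ : Equiv.Perm (Fin n)) (L : Fin n → LocalDatum), monomial σ L = g :=
  ⟨permOf hg, localOf hg, monomial_permOf_localOf hg⟩

/-- The permutation of a monomial map is recovered: `σ_{monomial σ L} = σ`. [cite: CalderbankEtAl1998, §3 (printed p. 11)] -/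
theorem qubitOf_monomial (σ : Equiv.Perm (Fin n)) (L : Fin n → LocalDatum) (q : Fin n) :
    qubitOf (monomial_mem_codeEquivGroup σ L) q = σ q := by
  have h := apply_X_eq (monomial_mem_codeEquivGroup σ L) q
  have hl := congrArg (fun w => letterAt w (σ q)) h
  simp only [monomial_apply, letterAt_monomialMap, letterAt_singleErr', Equiv.symm_apply_apply, if_true] at hl
  by_contra hne
  rw [if_neg (Ne.symm hne)] at hl
  exact ((L q).act_ne_zero_iff (1, 0)).2 (by decide) hl

/-- The local data of a monomial map are recovered. [cite: CalderbankEtAl1998, §3 (printed p. 11)] -/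
theorem localOf_monomial (σ : Equiv.Perm (Fin n)) (L : Fin n → LocalDatum) (q : Fin n) :
    localOf (monomial_mem_codeEquivGroup σ L) q = L q := by
  have hq := qubitOf_monomial σ L q
  have hX := congrArg (fun w => letterAt w (σ q)) (apply_X_eq (monomial_mem_codeEquivGroup σ L) q)
  have hZ := congrArg (fun w => letterAt w (σ q)) (apply_Z_eq (monomial_mem_codeEquivGroup σ L) q)
  simp only [monomial_apply, letterAt_monomialMap, letterAt_singleErr', Equiv.symm_apply_apply, if_true, hq] at hX hZ
  apply Subtype.ext
  simp only [localOf]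
  refine Prod.ext ?_ ?_
  · rw [← hX]; simp [LocalDatum.act]
  · rw [← hZ]; simp [LocalDatum.act]

end Structure

/-- **`𝒢ₙ = S₃ ≀ Sₙ`**: the elements of `𝒢ₙ` correspond bijectively to the pairs (coordinate permutation, local
letter permutations). [cite: CalderbankEtAl1998, §3 (printed p. 11: "Equivalently, 𝒢ₙ is the wreath product of S₃ by Sₙ …")] -/
noncomputable def codeEquivGroupEquiv (n : ℕ) : codeEquivGroup n ≃ Equiv.Perm (Fin n) × (Fin n → LocalDatum) where
  toFun g := (permOf g.2, localOf g.2)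
  invFun d := ⟨monomial d.1 d.2, monomial_mem_codeEquivGroup d.1 d.2⟩
  left_inv g := Subtype.ext (monomial_permOf_localOf g.2)
  right_inv d := by
    refine Prod.ext (Equiv.ext fun q => ?_) (funext fun q => ?_)
    · exact qubitOf_monomial d.1 d.2 q
    · exact localOf_monomial d.1 d.2 q

/-- **"`𝒢ₙ`, the group of order `6ⁿ n!`."** [cite: CalderbankEtAl1998, §3 (printed p. 11)] -/
theorem card_codeEquivGroup (n : ℕ) : Nat.card (codeEquivGroup n) = 6 ^ n * n.factorial := by
  rw [Nat.card_congr (codeEquivGroupEquiv n), Nat.card_prod, Nat.card_perm, Nat.card_fun, card_localDatum,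
    Nat.card_eq_fintype_card, Fintype.card_fin, mul_comm]

/-! ### §5. The action on codes, `Aut(S̄)`, and eq. (6) -/

/-- The action of `g ∈ 𝒢ₙ` on a code `S̄ ≤ Ē` is the image: `g • S̄ = S̄.map g` (Mathlib's pointwise action).
[cite: CalderbankEtAl1998, §3 (printed p. 11: codes obtained from one another by applying an element of 𝒢ₙ)] -/
theorem smul_eq_map (g : codeEquivGroup n) (S : Submodule (ZMod 2) (SympVec n)) :
    g • S = S.map ((g : SympVec n ≃ₗ[ZMod 2] SympVec n) : SympVec n →ₗ[ZMod 2] SympVec n) :=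
  Submodule.ext fun _ => Iff.rfl

/-- Membership in a translate: `v ∈ g • S̄ ↔ g⁻¹ v ∈ S̄`. [cite: CalderbankEtAl1998, §3 (printed p. 11)] -/
theorem mem_smul_iff (g : codeEquivGroup n) (S : Submodule (ZMod 2) (SympVec n)) (v : SympVec n) :
    v ∈ g • S ↔ (g : SympVec n ≃ₗ[ZMod 2] SympVec n).symm v ∈ S := by
  rw [smul_eq_map, Submodule.mem_map]
  constructor
  · rintro ⟨w, hw, rfl⟩
    rwa [LinearEquiv.coe_coe, LinearEquiv.symm_apply_apply]
  · intro h
    exact ⟨_, h, (g : SympVec n ≃ₗ[ZMod 2] SympVec n).apply_symm_apply v⟩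

/-- **Equivalent codes have the same parameters**: `g • S̄` is an `[[n,k,d]]` additive code iff `S̄` is.
[cite: CalderbankEtAl1998, §3 (printed p. 11: equivalent codes)] -/
theorem isAdditiveCode_smul_iff (g : codeEquivGroup n) (S : Submodule (ZMod 2) (SympVec n)) (k d : ℕ) :
    IsAdditiveCode (g • S) k d ↔ IsAdditiveCode S k d := by
  constructor
  · intro h
    have h' := h.map_isometry (g := (g⁻¹ : codeEquivGroup n)) (g⁻¹).2
    rw [← smul_eq_map, ← mul_smul, inv_mul_cancel, one_smul] at h'
    exact h'
  · intro h
    rw [smul_eq_map]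
    exact h.map_isometry g.2

/-- Self-orthogonality is preserved by `𝒢ₙ`. [cite: CalderbankEtAl1998, §3 (printed p. 11: 𝒢ₙ preserves trace inner products)] -/
theorem isSelfOrthogonal_smul_iff (g : codeEquivGroup n) (S : Submodule (ZMod 2) (SympVec n)) :
    IsSelfOrthogonal (g • S) ↔ IsSelfOrthogonal S := by
  have key : ∀ (h : codeEquivGroup n) (T : Submodule (ZMod 2) (SympVec n)),
      IsSelfOrthogonal T → IsSelfOrthogonal (h • T) := by
    intro h T hT v hv
    rw [mem_smul_iff] at hv
    rw [mem_sympDual_iff]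
    intro w hw
    rw [mem_smul_iff] at hw
    have hsymm : IsSympIsometry (h : SympVec n ≃ₗ[ZMod 2] SympVec n).symm := (codeEquivGroup n).inv_mem h.2
    have := mem_sympDual_iff.1 (hT hv) _ hw
    rwa [hsymm.1] at this
  refine ⟨fun h => ?_, key g S⟩
  have := key g⁻¹ _ h
  rwa [← mul_smul, inv_mul_cancel, one_smul] at this

/-- The dimension is preserved by `𝒢ₙ`. [cite: CalderbankEtAl1998, §3 (printed p. 11)] -/
theorem finrank_smul (g : codeEquivGroup n) (S : Submodule (ZMod 2) (SympVec n)) :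
    Module.finrank (ZMod 2) ↥(g • S) = Module.finrank (ZMod 2) S := by
  rw [smul_eq_map]
  exact LinearEquiv.finrank_map_eq _ _

/-- **CRSS eq. (6) (orbit–stabilizer): the number of codes equivalent to `S̄` times `|Aut(S̄)|` is `6ⁿ n!`.**
Here the equivalence class of `S̄` is `MulAction.orbit 𝒢ₙ S̄` and `Aut(S̄) = MulAction.stabilizer 𝒢ₙ S̄` ("the
subgroup of `𝒢ₙ` fixing a code `C`").
[cite: CalderbankEtAl1998, §3 eq. (6) (printed p. 11: "The number of codes equivalent to C is then equal to 6ⁿn!/|Aut(C)|")] -/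
theorem CRSS1998_eq6 (S : Submodule (ZMod 2) (SympVec n)) :
    Nat.card (MulAction.orbit (codeEquivGroup n) S) * Nat.card (MulAction.stabilizer (codeEquivGroup n) S) =
      6 ^ n * n.factorial := by
  rw [← card_codeEquivGroup, Nat.card_coe_set_eq (MulAction.orbit (codeEquivGroup n) S), ← MulAction.index_stabilizer,
    Subgroup.index_mul_card]

/-- `Aut(S̄)` is a nonempty finite group: `1 ≤ |Aut(S̄)|`, and `|Aut(S̄)|` divides `6ⁿ n!`.
[cite: CalderbankEtAl1998, §3 eq. (6) (printed p. 11)] -/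
theorem card_stabilizer_pos_and_dvd (S : Submodule (ZMod 2) (SympVec n)) :
    0 < Nat.card (MulAction.stabilizer (codeEquivGroup n) S) ∧
      Nat.card (MulAction.stabilizer (codeEquivGroup n) S) ∣ 6 ^ n * n.factorial := by
  haveI := finite_codeEquivGroup n
  refine ⟨Nat.card_pos, ?_⟩
  rw [← card_codeEquivGroup]
  exact Subgroup.card_subgroup_dvd_card _

/-- **CRSS eq. (6), quotient form**: the number of codes equivalent to `S̄` is `6ⁿ n! / |Aut(S̄)|` (exact division).
[cite: CalderbankEtAl1998, §3 eq. (6) (printed p. 11)] -/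
theorem card_orbit_eq_div (S : Submodule (ZMod 2) (SympVec n)) :
    Nat.card (MulAction.orbit (codeEquivGroup n) S) =
      6 ^ n * n.factorial / Nat.card (MulAction.stabilizer (codeEquivGroup n) S) := by
  rw [← CRSS1998_eq6 S, Nat.mul_div_cancel _ (card_stabilizer_pos_and_dvd S).1]

/-! ### §6. The mass formula over equivalence classes -/

/-- **Mass formula over equivalence classes (transversal form).** For any `𝒢ₙ`-invariant finite set `X` of codes and
any complete system `R ⊆ X` of representatives of the equivalence classes meeting `X` (every `S̄ ∈ X` is equivalent to
exactly one `C ∈ R`): `Σ_{C ∈ R} 6ⁿ n! / |Aut(C)| = |X|` — the sum of eq. (6) over the classes. This is the identity by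
which an enumeration of codes up to equivalence is checked for completeness ("A missing class, a duplicated class or a
wrong |Aut| each break this identity").
[cite: CalderbankEtAl1998, §3 eq. (6) (printed p. 11) and §6 Thm. 19 (b) (printed p. 23: "(b) From (a) and (6)"); HuffmanPless2003, §9.10 Thm. 9.10.5] -/
theorem sum_card_div_card_stabilizer_eq_card {X R : Finset (Submodule (ZMod 2) (SympVec n))}
    (hX : ∀ (g : codeEquivGroup n), ∀ S ∈ X, g • S ∈ X) (hR : ∀ C ∈ R, C ∈ X)
    (huniq : ∀ S ∈ X, ∃! C, C ∈ R ∧ S ∈ MulAction.orbit (codeEquivGroup n) C) :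
    ∑ C ∈ R, 6 ^ n * n.factorial / Nat.card (MulAction.stabilizer (codeEquivGroup n) C) = #X := by
  -- the class map `S ↦ its representative in R`
  let rep : Submodule (ZMod 2) (SympVec n) → Submodule (ZMod 2) (SympVec n) := fun S =>
    if h : S ∈ X then Classical.choose (huniq S h) else S
  have hrep : ∀ S (h : S ∈ X), rep S ∈ R ∧ S ∈ MulAction.orbit (codeEquivGroup n) (rep S) := by
    intro S h
    simp only [rep, dif_pos h]
    exact (Classical.choose_spec (huniq S h)).1
  have hmaps : (X : Set (Submodule (ZMod 2) (SympVec n))).MapsTo rep R := fun S hS => (hrep S hS).1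
  rw [Finset.card_eq_sum_card_fiberwise hmaps]
  refine Finset.sum_congr rfl fun C hC => ?_
  -- the fibre over `C ∈ R` is the orbit of `C`
  have hfib : (MulAction.orbit (codeEquivGroup n) C : Set (Submodule (ZMod 2) (SympVec n))) =
      ↑(X.filter fun S => rep S = C) := by
    ext S
    simp only [Finset.coe_filter, Set.mem_setOf_eq]
    constructor
    · intro hS
      obtain ⟨g, rfl⟩ := MulAction.mem_orbit_iff.1 hS
      have hgC : g • C ∈ X := hX g C (hR C hC)
      refine ⟨hgC, ?_⟩
      exact ((huniq _ hgC).unique ⟨(hrep _ hgC).1, (hrep _ hgC).2⟩ ⟨hC, MulAction.mem_orbit _ _⟩)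
    · rintro ⟨hS, hSC⟩
      rw [← hSC]
      exact (hrep S hS).2
  rw [← card_orbit_eq_div, Nat.card_coe_set_eq, hfib, Set.ncard_coe_finset]

/-! ### §7. `[[n, n−m]]` codes: the census identity and CRSS Theorem 19 (b) -/

/-- `𝒢ₙ` preserves the set of `m`-dimensional self-orthogonal codes. [cite: CalderbankEtAl1998, §3 (printed p. 11: 𝒢ₙ preserves weights and trace inner products)] -/
theorem smul_mem_isoSubspaces_iff (g : codeEquivGroup n) {m : ℕ} (S : Submodule (ZMod 2) (SympVec n)) :
    g • S ∈ isoSubspaces n m ↔ S ∈ isoSubspaces n m := by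
  rw [mem_isoSubspaces_iff, mem_isoSubspaces_iff, isSelfOrthogonal_smul_iff, finrank_smul]

/-- **The mass formula over equivalence classes of `[[n, n−m]]` stabilizer codes**: for a complete system `R` of
representatives of the classes of `m`-dimensional self-orthogonal `S̄ ≤ Ē`,
`Σ_{C ∈ R} 6ⁿ n! / |Aut(C)| = #isoSubspaces(n, m)` (`= ∏_{i<m}(2^{2n−i} − 2^i) / ∏_{i<m}(2^m − 2^i)` by
`card_isoSubspaces`). [cite: CalderbankEtAl1998, §3 eq. (6) (printed p. 11) with §6 Thm. 19 (printed p. 23); HuffmanPless2003, §9.10 Thm. 9.10.5] -/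
theorem massFormula_classes {m : ℕ} {R : Finset (Submodule (ZMod 2) (SympVec n))}
    (hR : ∀ C ∈ R, C ∈ isoSubspaces n m)
    (huniq : ∀ S ∈ isoSubspaces n m, ∃! C, C ∈ R ∧ S ∈ MulAction.orbit (codeEquivGroup n) C) :
    ∑ C ∈ R, 6 ^ n * n.factorial / Nat.card (MulAction.stabilizer (codeEquivGroup n) C) = #(isoSubspaces n m) :=
  sum_card_div_card_stabilizer_eq_card (fun g S hS => (smul_mem_isoSubspaces_iff g S).2 hS) hR huniq

/-- The same with the explicit product: `Σ_{C ∈ R} 6ⁿ n!/|Aut(C)| · ∏_{i<m}(2^m − 2^i) = ∏_{i<m}(2^{2n−i} − 2^i)`.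
[cite: CalderbankEtAl1998, §3 eq. (6) (printed p. 11) with §6 Thm. 19 (printed p. 23)] -/
theorem massFormula_classes_mul {m : ℕ} {R : Finset (Submodule (ZMod 2) (SympVec n))}
    (hR : ∀ C ∈ R, C ∈ isoSubspaces n m)
    (huniq : ∀ S ∈ isoSubspaces n m, ∃! C, C ∈ R ∧ S ∈ MulAction.orbit (codeEquivGroup n) C) :
    (∑ C ∈ R, 6 ^ n * n.factorial / Nat.card (MulAction.stabilizer (codeEquivGroup n) C)) *
        ∏ i ∈ Finset.range m, (2 ^ m - 2 ^ i) = ∏ i ∈ Finset.range m, (2 ^ (2 * n - i) - 2 ^ i) := by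
  rw [massFormula_classes hR huniq, card_isoSubspaces_mul]

/-- **CRSS Theorem 19 (b).** "`Σ 1/|Aut(C)| = ∏_{j=1}^{n}(2^j+1) / (6ⁿ n!)`, where the sum is over all inequivalent
self-dual codes `C` of length `n`": for every complete set `R` of representatives of the equivalence classes of the
self-dual `S̄ ≤ Ē` (`S̄⊥ = S̄`). [cite: CalderbankEtAl1998, §6 Thm. 19 (b) (printed p. 23: "Proof. … (b) From (a) and (6)"); HuffmanPless2003, §9.10 Thm. 9.10.5 (i)] -/
theorem CRSS1998_theorem19b {R : Finset (Submodule (ZMod 2) (SympVec n))} (hR : ∀ C ∈ R, sympDual C = C)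
    (huniq : ∀ S : Submodule (ZMod 2) (SympVec n), sympDual S = S →
      ∃! C, C ∈ R ∧ S ∈ MulAction.orbit (codeEquivGroup n) C) :
    ∑ C ∈ R, (1 : ℚ) / Nat.card (MulAction.stabilizer (codeEquivGroup n) C) =
      (∏ j ∈ Finset.Icc 1 n, (2 ^ j + 1) : ℚ) / (6 ^ n * n.factorial) := by
  have hnat : ∑ C ∈ R, 6 ^ n * n.factorial / Nat.card (MulAction.stabilizer (codeEquivGroup n) C) =
      ∏ j ∈ Finset.Icc 1 n, (2 ^ j + 1) := by
    rw [← card_selfDualCodes]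
    refine massFormula_classes (fun C hC => mem_isoSubspaces_iff.2 (sympDual_eq_self_iff.1 (hR C hC)))
      fun S hS => huniq S (sympDual_eq_self_iff.2 (mem_isoSubspaces_iff.1 hS))
  have hG : ((6 : ℚ) ^ n * (n.factorial : ℚ)) ≠ 0 := by positivity
  have hcast : ((∑ C ∈ R, 6 ^ n * n.factorial / Nat.card (MulAction.stabilizer (codeEquivGroup n) C) : ℕ) : ℚ) =
      ((6 : ℚ) ^ n * (n.factorial : ℚ)) * ∑ C ∈ R, (1 : ℚ) / Nat.card (MulAction.stabilizer (codeEquivGroup n) C) := by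
    rw [Nat.cast_sum, Finset.mul_sum]
    refine Finset.sum_congr rfl fun C _ => ?_
    obtain ⟨hpos, hdvd⟩ := card_stabilizer_pos_and_dvd C
    rw [Nat.cast_div hdvd (by exact_mod_cast hpos.ne'), mul_one_div]
    push_cast
    rfl
  have h := congrArg (fun x : ℕ => (x : ℚ)) hnat
  simp only [hcast] at h
  push_cast at h
  rw [eq_div_iff hG, mul_comm]
  exact h

/-! ### §8. The printed generators: coordinate permutations, `ω`-multiplications, conjugations -/

/-- The identity local datum `(X, Z)`. [cite: CalderbankEtAl1998, §3 (printed p. 11)] -/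
def LocalDatum.idDatum : LocalDatum := ⟨((1, 0), (0, 1)), by decide⟩

/-- The local datum of multiplication by `ω` in one coordinate: `X = (1|0) ↦ Z = (0|1)`, `Z ↦ Y = (1|1)`
(`ω·φ(a|b) = φ(b|a+b)`, cf. `omegaMul` of `GF4LinearCodes.lean`).
[cite: CalderbankEtAl1998, §3 (printed p. 11: "multiplication of any coordinates by ω")] -/
def LocalDatum.omegaDatum : LocalDatum := ⟨((0, 1), (1, 1)), by decide⟩

/-- The local datum of conjugation `ω ↔ ω̄` in one coordinate: `X ↔ Z` (`φ(a|b) = ωa + ω̄b ↦ ω̄a + ωb = φ(b|a)`).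
[cite: CalderbankEtAl1998, §3 (printed p. 11: "conjugation of any coordinates")] -/
def LocalDatum.conjDatum : LocalDatum := ⟨((0, 1), (1, 0)), by decide⟩

/-- Composition of local data (composition of the letter permutations). [cite: CalderbankEtAl1998, §3 (printed p. 11)] -/
def LocalDatum.comp (D D' : LocalDatum) : LocalDatum :=
  ⟨(D.act D'.1.1, D.act D'.1.2), by rw [LocalDatum.letterForm_act]; exact D'.2⟩

/-- The identity datum acts trivially. [cite: CalderbankEtAl1998, §3 (printed p. 11)] -/
@[simp] theorem LocalDatum.idDatum_act (p : ZMod 2 × ZMod 2) : LocalDatum.idDatum.act p = p := by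
  revert p; unfold LocalDatum.act LocalDatum.idDatum; decide

/-- The action of a composite datum is the composite action. [cite: CalderbankEtAl1998, §3 (printed p. 11)] -/
theorem LocalDatum.comp_act (D D' : LocalDatum) (p : ZMod 2 × ZMod 2) : (D.comp D').act p = D.act (D'.act p) := by
  obtain ⟨⟨a, b⟩, hab⟩ := D
  obtain ⟨⟨a', b'⟩, hab'⟩ := D'
  revert a b a' b' p
  unfold LocalDatum.comp LocalDatum.act letterForm
  decide

/-- `S₃ = ⟨ω, conjugation⟩`: every local datum is one of `id, ω, ω², c, cω, cω²`.
[cite: CalderbankEtAl1998, §3 (printed p. 11: "Equivalently … arbitrary permutations of the nonzero elements of GF(4) in each coordinate")] -/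
theorem LocalDatum.eq_words (D : LocalDatum) :
    D = LocalDatum.idDatum ∨ D = LocalDatum.omegaDatum ∨ D = LocalDatum.omegaDatum.comp LocalDatum.omegaDatum ∨
      D = LocalDatum.conjDatum ∨ D = LocalDatum.conjDatum.comp LocalDatum.omegaDatum ∨
        D = LocalDatum.conjDatum.comp (LocalDatum.omegaDatum.comp LocalDatum.omegaDatum) := by
  revert D
  unfold LocalDatum LocalDatum.comp LocalDatum.act LocalDatum.idDatum LocalDatum.omegaDatum LocalDatum.conjDatum
    letterForm
  decide

/-- `(1 : Sₙ)⁻¹ p = p`. [folklore] -/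
private theorem perm_one_symm_apply (p : Fin n) : (1 : Equiv.Perm (Fin n)).symm p = p := rfl

/-- The **local map** of a datum `D` at coordinate `q` (all other coordinates fixed): `monomial 1 (q ↦ D, else id)`.
[cite: CalderbankEtAl1998, §3 (printed p. 11: "multiplication of any coordinates by ω, and conjugation of any coordinates")] -/
noncomputable def localAt (q : Fin n) (D : LocalDatum) : SympVec n ≃ₗ[ZMod 2] SympVec n :=
  monomial 1 (Function.update (fun _ => LocalDatum.idDatum) q D)

/-- **Multiplication of coordinate `q` by `ω`.** [cite: CalderbankEtAl1998, §3 (printed p. 11)] -/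
noncomputable def omegaAt (q : Fin n) : SympVec n ≃ₗ[ZMod 2] SympVec n := localAt q LocalDatum.omegaDatum

/-- **Conjugation of coordinate `q`.** [cite: CalderbankEtAl1998, §3 (printed p. 11)] -/
noncomputable def conjAt (q : Fin n) : SympVec n ≃ₗ[ZMod 2] SympVec n := localAt q LocalDatum.conjDatum

/-- The letters of a local map: `D` on coordinate `q`, identity elsewhere. [cite: CalderbankEtAl1998, §3 (printed p. 11)] -/
theorem letterAt_localAt (q : Fin n) (D : LocalDatum) (v : SympVec n) (p : Fin n) :
    letterAt (localAt q D v) p = if p = q then D.act (letterAt v p) else letterAt v p := by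
  rw [localAt, monomial_apply, letterAt_monomialMap]
  simp only [perm_one_symm_apply, Function.update_apply]
  by_cases h : p = q
  · rw [if_pos h, if_pos h]
  · rw [if_neg h, if_neg h, LocalDatum.idDatum_act]

/-- Local maps lie in `𝒢ₙ`. [cite: CalderbankEtAl1998, §3 (printed p. 11)] -/
theorem localAt_mem_codeEquivGroup (q : Fin n) (D : LocalDatum) : localAt q D ∈ codeEquivGroup n :=
  monomial_mem_codeEquivGroup _ _

/-- Local maps at one coordinate compose as their data. [cite: CalderbankEtAl1998, §3 (printed p. 11)] -/
theorem localAt_comp (q : Fin n) (D D' : LocalDatum) : localAt q (D.comp D') = localAt q D * localAt q D' := by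
  refine LinearEquiv.ext fun v => ext_letterAt fun p => ?_
  rw [LinearEquiv.mul_eq_trans, LinearEquiv.trans_apply, letterAt_localAt, letterAt_localAt, letterAt_localAt]
  by_cases h : p = q
  · rw [if_pos h, if_pos h, if_pos h, LocalDatum.comp_act]
  · rw [if_neg h, if_neg h, if_neg h]

/-- The local map of the identity datum is the identity. [cite: CalderbankEtAl1998, §3 (printed p. 11)] -/
theorem localAt_idDatum (q : Fin n) : localAt q LocalDatum.idDatum = 1 := by
  refine LinearEquiv.ext fun v => ext_letterAt fun p => ?_
  rw [letterAt_localAt]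
  by_cases h : p = q
  · rw [if_pos h, LocalDatum.idDatum_act]; rfl
  · rw [if_neg h]; rfl

/-- The set of PRINTED GENERATORS of `𝒢ₙ`: coordinate permutations, multiplications of one coordinate by `ω`,
conjugations of one coordinate. [cite: CalderbankEtAl1998, §3 (printed p. 11: "generated by permutations of the n coordinates, multiplication of any coordinates by ω, and conjugation of any coordinates")] -/
def printedGenerators (n : ℕ) : Set (SympVec n ≃ₗ[ZMod 2] SympVec n) :=
  Set.range (permQubits (n := n)) ∪ Set.range (omegaAt (n := n)) ∪ Set.range (conjAt (n := n))

/-- Every local map is a word in the printed generators at its coordinate (`S₃ = ⟨ω, c⟩`).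
[cite: CalderbankEtAl1998, §3 (printed p. 11)] -/
theorem localAt_mem_closure (q : Fin n) (D : LocalDatum) : localAt q D ∈ Subgroup.closure (printedGenerators n) := by
  have hω : omegaAt q ∈ Subgroup.closure (printedGenerators n) :=
    Subgroup.subset_closure (Or.inl (Or.inr ⟨q, rfl⟩))
  have hc : conjAt q ∈ Subgroup.closure (printedGenerators n) :=
    Subgroup.subset_closure (Or.inr ⟨q, rfl⟩)
  rcases LocalDatum.eq_words D with h | h | h | h | h | h <;> rw [h]
  · rw [localAt_idDatum]; exact Subgroup.one_mem _
  · exact hω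
  · rw [localAt_comp]; exact Subgroup.mul_mem _ hω hω
  · exact hc
  · rw [localAt_comp]; exact Subgroup.mul_mem _ hc hω
  · rw [localAt_comp, localAt_comp]; exact Subgroup.mul_mem _ hc (Subgroup.mul_mem _ hω hω)

/-- Peeling one coordinate off a diagonal monomial map: `monomial 1 L = localAt a (L a) * monomial 1 (L with a ↦ id)`.
[cite: CalderbankEtAl1998, §3 (printed p. 11)] -/
theorem monomial_one_eq_localAt_mul (L : Fin n → LocalDatum) (a : Fin n) :
    monomial 1 L = localAt a (L a) * monomial 1 (Function.update L a LocalDatum.idDatum) := by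
  refine LinearEquiv.ext fun v => ext_letterAt fun p => ?_
  rw [LinearEquiv.mul_eq_trans, LinearEquiv.trans_apply, monomial_apply, monomial_apply, letterAt_localAt,
    letterAt_monomialMap, letterAt_monomialMap]
  simp only [perm_one_symm_apply, Function.update_apply]
  by_cases h : p = a
  · subst h; rw [if_pos rfl, if_pos rfl, LocalDatum.idDatum_act]
  · rw [if_neg h, if_neg h]

/-- Every diagonal monomial map (no coordinate permutation) is a product of local maps, hence in the closure of the
printed generators. [cite: CalderbankEtAl1998, §3 (printed p. 11)] -/
theorem monomial_one_mem_closure (L : Fin n → LocalDatum) : monomial 1 L ∈ Subgroup.closure (printedGenerators n) := by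
  -- induction on a finite set of coordinates outside which `L` is the identity datum
  suffices h : ∀ (A : Finset (Fin n)) (L : Fin n → LocalDatum), (∀ q, q ∉ A → L q = LocalDatum.idDatum) →
      monomial 1 L ∈ Subgroup.closure (printedGenerators n) from h Finset.univ L (fun q hq => absurd (Finset.mem_univ q) hq)
  intro A
  induction A using Finset.induction_on with
  | empty =>
    intro L hL
    have hL' : L = fun _ => LocalDatum.idDatum := funext fun q => hL q (Finset.notMem_empty q)
    have h1 : monomial (1 : Equiv.Perm (Fin n)) L = 1 := by
      refine LinearEquiv.ext fun v => ext_letterAt fun p => ?_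
      rw [monomial_apply, letterAt_monomialMap, hL']
      simp only [perm_one_symm_apply, LocalDatum.idDatum_act]
      rfl
    rw [h1]; exact Subgroup.one_mem _
  | insert a A ha ih =>
    intro L hL
    rw [monomial_one_eq_localAt_mul L a]
    refine Subgroup.mul_mem _ (localAt_mem_closure a (L a)) (ih _ fun q hq => ?_)
    by_cases hqa : q = a
    · subst hqa; rw [Function.update_self]
    · rw [Function.update_of_ne hqa]
      exact hL q (by simp [hqa, hq])

/-- A monomial map is its diagonal part after the coordinate permutation:
`monomial σ L = monomial 1 (L ∘ σ⁻¹) * permQubits σ`. [cite: CalderbankEtAl1998, §3 (printed p. 11)] -/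
theorem monomial_eq_mul_permQubits (σ : Equiv.Perm (Fin n)) (L : Fin n → LocalDatum) :
    monomial σ L = monomial 1 (L ∘ σ.symm) * permQubits σ := by
  refine LinearEquiv.ext fun v => ext_letterAt fun p => ?_
  rw [LinearEquiv.mul_eq_trans, LinearEquiv.trans_apply, monomial_apply, monomial_apply, letterAt_monomialMap,
    letterAt_monomialMap]
  simp only [perm_one_symm_apply, Function.comp_apply]
  rfl

/-- **`𝒢ₙ` is the group generated by the coordinate permutations, the multiplications of single coordinates by
`ω`, and the conjugations of single coordinates** — the printed definition of `𝒢ₙ` coincides with `codeEquivGroup n`.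
[cite: CalderbankEtAl1998, §3 (printed p. 11: "Let 𝒢ₙ denote the group of order 6ⁿn! generated by permutations of the n coordinates, multiplication of any coordinates by ω, and conjugation of any coordinates")] -/
theorem closure_printedGenerators (n : ℕ) : Subgroup.closure (printedGenerators n) = codeEquivGroup n := by
  refine le_antisymm ((Subgroup.closure_le _).2 ?_) fun g hg => ?_
  · rintro g ((⟨σ, rfl⟩ | ⟨q, rfl⟩) | ⟨q, rfl⟩)
    · exact permQubits_mem_codeEquivGroup σ
    · exact localAt_mem_codeEquivGroup q _
    · exact localAt_mem_codeEquivGroup q _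
  · obtain ⟨σ, L, rfl⟩ := exists_monomial_eq hg
    rw [monomial_eq_mul_permQubits]
    exact Subgroup.mul_mem _ (monomial_one_mem_closure _)
      (Subgroup.subset_closure (Or.inl (Or.inl ⟨σ, rfl⟩)))

end Literature.InformationTheory.QuantumCodes
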